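import Summits.QuantumFields.BalabanUV.Beta.GAN24.ContactCellRefineTip
import Summits.QuantumFields.BalabanUV.Beta.GAN24.ContactGaugeStaircaseCauchy
import Summits.QuantumFields.BalabanUV.Beta.GAN24.ContactCellLetters

/-!
# `BalabanUV.Beta.GAN24.ContactRefineBUnits` — binder row G-an2-4 / (CONV-C), the row owner's CONTACT-TERM ROUTE, **CT-4c-B at `d = 3`**, PART 1 of 2: THE UNIT
# LETTERS of the B-atoms of the contact cells (gauge weight × UNDRESSED partner × tent force) at towers `k` and `k+1`, and their three refinement letters, read off
# the suppliers' native letters — the hypotheses of my `ContactCellRefine.abs_refine3_le` ∕ `ContactCellRefineTip.abs_refine3_tip_le` in the cells' currency.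
# (PART 2 `ContactRefineBThree` = the three B-atom ENDs.)

NOT IN PRINT; OUR BOOKKEEPING (G-an2-4 formalisation swarm, leaf prover `b2b-balaban-gan24-formalise-leaf-02`, gen 50; INTENT «CT-4c-B THREE» journal
`CLAIMS.log` l.35669; the P-atoms (dressed partner's gauge part) are gan24-p2 g34's CT-4c-P `ContactRefineP*`).  HONEST FRAMING (cell contract, verbatim):
«discharging `BetaPertH` makes Bałaban's UV stability UNCONDITIONAL — a real constructive-QFT result; it is NOT the continuum limit and NOT the Clay problem.»
HONEST DEPENDENCY (verbatim): «continuum YM on T⁴ ⇐ BetaPertH ∧ nine spine estimates (0/9 proved); BetaPertH ⇐ (D1) ∧ (D4) ∧ CAP+tail; G-an2-4 gates asym,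
D1 and NE2/3/4.»

SETTING (`d = 3`, `Lc ≥ 2`, in-block root `ρ = toSite rr`; tower `k`: blocking `N = Lc^(k+1)`, bond gauge function of the datum `(α, x′)`
`λ_k u = Psi ρ Lc 0 k (delta1 α x′) u − bmGaugeAt ρ (respStep 1 (Lc^(k+1)) α x′) Lc u`, undressed partner `B_k κ u = respStep 1 (Lc^(k+1)) κ′ u′ κ u` of the datum
`(κ′, u′)`, tent force `t_k κ u = 𝒬ᵀ_N φ_{β,z′} κ u`, `φ_{β,z′} l y = wΦ_N l β (y − z′)` of the datum `(β, z′)` (= `d*d` of either partner at `m = 0`, leaf-01's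
`ContactCellLetters.curvAdj_curv_respStep_zero_eq_contourSumAdj` ∕ `…legChain…`); tower `k+1`: the same at `k+1`, on the `Lc`-times finer lattice).
UNITS: `N^4·λ`, `N^5·B`, `N^7·t` are `O(1)` with block envelopes `16C`, `C`, `Φ₀e^{κ₀}` (§1), so an atom `Σ'_u Σ_κ w·B·t` carries `N^{−16}·N^4 = N^{−12}`:
the comparison is `|N′^{12}·atom_{k+1} − N^{12}·atom_k|` (`N′ = Lc·N`; the hS0 assembly's weight is `cE·(cE·Lc^8)^{k+1} = Lc^4·N^{12}`, owner's part A).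

WHAT (0 `def`, 0 cited fact, 0 `def … : Prop`, 0 sorry; [folklore] unit bookkeeping BY NAME over my `ContactCellRefine` ∕ `…Tip`, leaf-01's `ContactCellLetters`,
p2's `ContactGaugeStaircaseCauchy`).  PARAMETRIC in five letter families at ONE rate `κ₀` (the existential wrapper discharging them by the suppliers —
(N1) `RespStepDecay`, the tent bound of `ContactAssembly.exists_common_letters`, leaf-01 g61's `RespStepRefine` (ε₁) and `ContactGaugeRefine` (εψ), p2 g34's
`ContactTentRefine.exists_tent_refine_three` (ε₃) — at the minimum rate is a separate short file once all five are in the tree):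
* §1 UNIT LETTERS: `abs_unitGauge_le` (`|N^4λ_k| ≤ 16C·E`), `abs_unitLeg_le` (`|N^5B_k| ≤ C·E`), `abs_unitTent_le` (`|N^7t_k| ≤ Φ₀e^{κ₀}·E`),
  `abs_unitLeg_refine_le` (`|N′^5B_{k+1} κ x − N^5B_k κ (quo Lc x)| ≤ c₁θ₁^k·E′`), `abs_unitTent_refine_le` (`≤ (Aθt^k + B·N⁻¹)·E′`), `abs_unitGauge_refine_le`
  (`≤ (16cθ^k + 8C·N⁻¹)·E′`), `unitGauge_eq_staircase` + `abs_unitGaugePiece_le` (pieces `N^4·G_k s`, amplitudes `8LcC·N⁻¹·Lc^s`), `sum_unitAmp_eq`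
  (`Σ_{s<k+1} a s·(Lc^s)⁻¹ = (k+1)·8LcC·N⁻¹`).
* §2 = PART 2 `ContactRefineBThree` (the three B-atom ENDs).
Discharges NOTHING of hSdev by itself (CT-4e adds the atoms per cell of leaf-01's `contact_legChain_ff_eq_cells`); 0 wall binders; NEVER «G-an2-4 closed» as (CONV-C);
NOT D1, NOT BetaPertH, NOT continuum, NOT Clay.
-/

noncomputable section

open Finset
open scoped BigOperators
open Literature.MathematicalPhysics.QuantumFieldTheory
open Literature.MathematicalPhysics.QuantumFieldTheory.LatticeForm (quo)
open Literature.MathematicalPhysics.QuantumFieldTheory.Balaban1983to89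
open Literature.MathematicalPhysics.QuantumFieldTheory.Balaban1983to89.Beta
open B4ContourShift (supNorm supNorm_nonneg)
open ExpKernelCalculus (Zl Zl_nonneg)
open AffineAveraging (Form0 Form1 Site box toSite)
open AffineReproduction (contourSumAdj)
open AveragingContours (blk)
open KernelSpecInstance (wΦ)
open B6BondElimination (unitVec unitVec_apply)
open KKTFluctuationKernel (delta1)
open BalabanCompositeJets (respStep)
open Summit.QuantumFields.BalabanUV.Beta.AxialProjectorBlockMean (bmGaugeAt)
open Summit.QuantumFields.BalabanUV.Beta.GAN24.RespStepBmDecompLegs (legAct)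
open Summit.QuantumFields.BalabanUV.Beta.GAN24.RespStepBmDecompPsi (Psi)
open Summit.QuantumFields.BalabanUV.Beta.GAN24.StaircaseFaces (quo_quo)
open Summit.QuantumFields.BalabanUV.Beta.GAN24.ContactGaugeStaircaseCauchy (gauge_eq_staircase_zero abs_gaugePieceZero_le)
open Summit.QuantumFields.BalabanUV.Beta.GAN24.ContactCellLetters (abs_gauge_le)
open Summit.QuantumFields.BalabanUV.Beta.GAN24.ContactCellRefine (quo_quo')

namespace Summit.QuantumFields.BalabanUV.Beta.GAN24.ContactRefineBUnits

variable {Lc : ℕ} [NeZero Lc]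

/-! ## §1 The unit letters (`d = 3`) -/

section Units

variable {κ₀ C Φ₀ c₁ θ₁ A B θt c θ : ℝ} {rr : Fin (3 + 1) → ℕ}

/-- [folklore] Power bookkeeping: `x^a · x^b · (x^c)⁻¹ = 1` for `a + b = c`, `x ≠ 0`. -/
theorem pow_mul_pow_mul_inv_eq_one {x : ℝ} (hx : x ≠ 0) {a b c : ℕ} (h : a + b = c) : x ^ a * x ^ b * (x ^ c)⁻¹ = 1 := by
  rw [← pow_add, h, mul_inv_cancel₀ (pow_ne_zero _ hx)]

/-- NOT IN PRINT; OUR BOOKKEEPING.  **THE UNIT GAUGE FUNCTION** `N^4·λ_k` has the `k`-FREE block envelope `16C` (leaf-01's `ContactCellLetters.abs_gauge_le`: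
`|λ_k| ≤ 2·(8LcC(Lc^{5(k+1)})⁻¹)·Lc^k`, and `N^4·Lc·Lc^k = Lc^{5(k+1)}`). -/
theorem abs_unitGauge_le (hLc : 2 ≤ Lc) (hC : 0 ≤ C)
    (hN1 : ∀ (m k : ℕ) (μ : Fin (3 + 1)) (z : Site (3 + 1)) (l'' : Fin (3 + 1)) (w' : Site (3 + 1)),
      |respStep (d := 3) (Lc ^ m) (Lc ^ (m + k + 1)) μ z l'' w'| ≤
        C * ((Lc : ℝ) ^ (5 * (k + 1)))⁻¹ * Real.exp (-(κ₀ * supNorm (quo (Lc ^ (k + 1)) w' - z))))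
    (hrr : rr ∈ box (3 + 1) Lc) (k : ℕ) (μ : Fin (3 + 1)) (z u : Site (3 + 1)) :
    |((Lc : ℝ) ^ (k + 1)) ^ 4 * (Psi (toSite rr) Lc 0 k (delta1 μ z) u - bmGaugeAt (toSite rr) (respStep (d := 3) 1 (Lc ^ (k + 1)) μ z) Lc u)|
      ≤ 16 * C * Real.exp (-(κ₀ * supNorm (quo (Lc ^ (k + 1)) u - z))) := by
  have hL0 : (Lc : ℝ) ≠ 0 := by exact_mod_cast NeZero.ne Lc
  have h := abs_gauge_le (Lc := Lc) hLc hC hN1 hrr k μ z u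
  rw [pow_zero, Nat.zero_add] at h
  rw [abs_mul, abs_of_nonneg (by positivity)]
  calc ((Lc : ℝ) ^ (k + 1)) ^ 4 * |Psi (toSite rr) Lc 0 k (delta1 μ z) u - bmGaugeAt (toSite rr) (respStep (d := 3) 1 (Lc ^ (k + 1)) μ z) Lc u|
      ≤ ((Lc : ℝ) ^ (k + 1)) ^ 4 *
          ((2 * (8 * (Lc : ℝ) * C * ((Lc : ℝ) ^ (5 * (k + 1)))⁻¹) * (Lc : ℝ) ^ k) * Real.exp (-(κ₀ * supNorm (quo (Lc ^ (k + 1)) u - z)))) :=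
        mul_le_mul_of_nonneg_left h (by positivity)
    _ = 16 * C * (((Lc : ℝ) ^ ((k + 1) * 4) * (Lc : ℝ) ^ (k + 1) * ((Lc : ℝ) ^ (5 * (k + 1)))⁻¹)) *
          Real.exp (-(κ₀ * supNorm (quo (Lc ^ (k + 1)) u - z))) := by
        rw [← pow_mul, pow_succ' (Lc : ℝ) k]; ring
    _ = 16 * C * Real.exp (-(κ₀ * supNorm (quo (Lc ^ (k + 1)) u - z))) := by
        rw [pow_mul_pow_mul_inv_eq_one hL0 (by ring), mul_one]

/-- NOT IN PRINT; OUR BOOKKEEPING.  **THE UNIT UNDRESSED LEG** `N^5·B_k` has the block envelope `C` ((N1) at `m = 0`). -/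
theorem abs_unitLeg_le
    (hN1 : ∀ (m k : ℕ) (μ : Fin (3 + 1)) (z : Site (3 + 1)) (l'' : Fin (3 + 1)) (w' : Site (3 + 1)),
      |respStep (d := 3) (Lc ^ m) (Lc ^ (m + k + 1)) μ z l'' w'| ≤
        C * ((Lc : ℝ) ^ (5 * (k + 1)))⁻¹ * Real.exp (-(κ₀ * supNorm (quo (Lc ^ (k + 1)) w' - z))))
    (k : ℕ) (μ : Fin (3 + 1)) (z : Site (3 + 1)) (l : Fin (3 + 1)) (w : Site (3 + 1)) :
    |((Lc : ℝ) ^ (k + 1)) ^ 5 * respStep (d := 3) 1 (Lc ^ (k + 1)) μ z l w| ≤ C * Real.exp (-(κ₀ * supNorm (quo (Lc ^ (k + 1)) w - z))) := by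
  have hL0 : (Lc : ℝ) ≠ 0 := by exact_mod_cast NeZero.ne Lc
  have h := hN1 0 k μ z l w
  rw [pow_zero, Nat.zero_add] at h
  have hC : 0 ≤ C * ((Lc : ℝ) ^ (5 * (k + 1)))⁻¹ * Real.exp (-(κ₀ * supNorm (quo (Lc ^ (k + 1)) w - z))) := (abs_nonneg _).trans h
  rw [abs_mul, abs_of_nonneg (by positivity)]
  calc ((Lc : ℝ) ^ (k + 1)) ^ 5 * |respStep (d := 3) 1 (Lc ^ (k + 1)) μ z l w|
      ≤ ((Lc : ℝ) ^ (k + 1)) ^ 5 * (C * ((Lc : ℝ) ^ (5 * (k + 1)))⁻¹ * Real.exp (-(κ₀ * supNorm (quo (Lc ^ (k + 1)) w - z)))) :=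
        mul_le_mul_of_nonneg_left h (by positivity)
    _ = C * ((Lc : ℝ) ^ ((k + 1) * 5) * (Lc : ℝ) ^ 0 * ((Lc : ℝ) ^ (5 * (k + 1)))⁻¹) * Real.exp (-(κ₀ * supNorm (quo (Lc ^ (k + 1)) w - z))) := by
        rw [← pow_mul, pow_zero]; ring
    _ = C * Real.exp (-(κ₀ * supNorm (quo (Lc ^ (k + 1)) w - z))) := by
        rw [pow_mul_pow_mul_inv_eq_one hL0 (by ring), mul_one]

/-- NOT IN PRINT; OUR BOOKKEEPING.  **THE UNIT TENT FORCE** `N^7·t_k` has the block envelope `Φ₀e^{κ₀}` (the translated tent bound of leaf-01's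
`ContactAssembly.exists_common_letters` (d): `|𝒬ᵀ_Nφ| ≤ N·Φ₀(Lc^{8(k+1)})⁻¹·e^{κ₀}·E`). -/
theorem abs_unitTent_le
    (ht : ∀ (k : ℕ) (μ : Fin (3 + 1)) (z : Site (3 + 1)) (κ : Fin (3 + 1)) (u : Site (3 + 1)),
      |contourSumAdj (Lc ^ (k + 1)) (fun κ y => wΦ (N := Lc ^ (k + 1)) κ μ (y - z)) κ u|
        ≤ (Lc ^ (k + 1) : ℕ) * (Φ₀ * ((Lc : ℝ) ^ (8 * (k + 1)))⁻¹) * Real.exp κ₀ * Real.exp (-(κ₀ * supNorm (quo (Lc ^ (k + 1)) u - z))))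
    (k : ℕ) (μ : Fin (3 + 1)) (z : Site (3 + 1)) (κ : Fin (3 + 1)) (u : Site (3 + 1)) :
    |((Lc : ℝ) ^ (k + 1)) ^ 7 * contourSumAdj (Lc ^ (k + 1)) (fun κ y => wΦ (N := Lc ^ (k + 1)) κ μ (y - z)) κ u|
      ≤ Φ₀ * Real.exp κ₀ * Real.exp (-(κ₀ * supNorm (quo (Lc ^ (k + 1)) u - z))) := by
  have hL0 : (Lc : ℝ) ≠ 0 := by exact_mod_cast NeZero.ne Lc
  have h := ht k μ z κ u
  push_cast at h
  have h0 : 0 ≤ (Lc : ℝ) ^ (k + 1) * (Φ₀ * ((Lc : ℝ) ^ (8 * (k + 1)))⁻¹) * Real.exp κ₀ * Real.exp (-(κ₀ * supNorm (quo (Lc ^ (k + 1)) u - z))) :=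
    (abs_nonneg _).trans h
  rw [abs_mul, abs_of_nonneg (by positivity)]
  calc ((Lc : ℝ) ^ (k + 1)) ^ 7 * |contourSumAdj (Lc ^ (k + 1)) (fun κ y => wΦ (N := Lc ^ (k + 1)) κ μ (y - z)) κ u|
      ≤ ((Lc : ℝ) ^ (k + 1)) ^ 7 *
          ((Lc : ℝ) ^ (k + 1) * (Φ₀ * ((Lc : ℝ) ^ (8 * (k + 1)))⁻¹) * Real.exp κ₀ * Real.exp (-(κ₀ * supNorm (quo (Lc ^ (k + 1)) u - z)))) :=
        mul_le_mul_of_nonneg_left h (by positivity)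
    _ = Φ₀ * Real.exp κ₀ * ((Lc : ℝ) ^ ((k + 1) * 7) * (Lc : ℝ) ^ (k + 1) * ((Lc : ℝ) ^ (8 * (k + 1)))⁻¹) *
          Real.exp (-(κ₀ * supNorm (quo (Lc ^ (k + 1)) u - z))) := by
        rw [← pow_mul]; ring
    _ = Φ₀ * Real.exp κ₀ * Real.exp (-(κ₀ * supNorm (quo (Lc ^ (k + 1)) u - z))) := by
        rw [pow_mul_pow_mul_inv_eq_one hL0 (by ring), mul_one]

/-- NOT IN PRINT; OUR BOOKKEEPING.  **THE UNIT UNDRESSED LEG, DIFFERENCED ACROSS THE TWO TOWERS** (leaf-01 g61's `RespStepRefine` shape = the T-N1C team's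
block-SAMPLE Cauchy letter: `|Lc^5·B_{k+1}(v) − B_k(quo Lc v)| ≤ c₁θ₁^k·(N^5)⁻¹·E′`): `|N′^5·B_{k+1} κ x − N^5·B_k κ (quo Lc x)| ≤ c₁θ₁^k·E′(x)`. -/
theorem abs_unitLeg_refine_le
    (hdB : ∀ (k : ℕ) (μ : Fin (3 + 1)) (z : Site (3 + 1)) (l : Fin (3 + 1)) (v : Site (3 + 1)),
      |(Lc : ℝ) ^ (3 + 2) * respStep (d := 3) 1 (Lc ^ (k + 1 + 1)) μ z l v - respStep (d := 3) 1 (Lc ^ (k + 1)) μ z l (quo Lc v)|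
        ≤ c₁ * θ₁ ^ k * (((Lc : ℝ) ^ (k + 1)) ^ (3 + 2))⁻¹ * Real.exp (-(κ₀ * supNorm (quo (Lc ^ (k + 1 + 1)) v - z))))
    (k : ℕ) (μ : Fin (3 + 1)) (z : Site (3 + 1)) (l : Fin (3 + 1)) (x : Site (3 + 1)) :
    |((Lc : ℝ) ^ (k + 2)) ^ 5 * respStep (d := 3) 1 (Lc ^ (k + 2)) μ z l x - ((Lc : ℝ) ^ (k + 1)) ^ 5 * respStep (d := 3) 1 (Lc ^ (k + 1)) μ z l (quo Lc x)|
      ≤ c₁ * θ₁ ^ k * Real.exp (-(κ₀ * supNorm (quo (Lc ^ (k + 2)) x - z))) := by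
  have hL0 : (Lc : ℝ) ≠ 0 := by exact_mod_cast NeZero.ne Lc
  have hN0 : ((Lc : ℝ) ^ (k + 1)) ^ 5 ≠ 0 := by positivity
  have h := hdB k μ z l x
  rw [show k + 1 + 1 = k + 2 from rfl] at h
  have h0 : 0 ≤ c₁ * θ₁ ^ k * (((Lc : ℝ) ^ (k + 1)) ^ (3 + 2))⁻¹ * Real.exp (-(κ₀ * supNorm (quo (Lc ^ (k + 2)) x - z))) :=
    (abs_nonneg _).trans h
  have e : ((Lc : ℝ) ^ (k + 2)) ^ 5 * respStep (d := 3) 1 (Lc ^ (k + 2)) μ z l x - ((Lc : ℝ) ^ (k + 1)) ^ 5 * respStep (d := 3) 1 (Lc ^ (k + 1)) μ z l (quo Lc x)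
      = ((Lc : ℝ) ^ (k + 1)) ^ 5 *
        ((Lc : ℝ) ^ (3 + 2) * respStep (d := 3) 1 (Lc ^ (k + 2)) μ z l x - respStep (d := 3) 1 (Lc ^ (k + 1)) μ z l (quo Lc x)) := by
    rw [pow_succ (Lc : ℝ) (k + 1), mul_pow]; ring
  rw [e, abs_mul, abs_of_nonneg (by positivity)]
  calc ((Lc : ℝ) ^ (k + 1)) ^ 5 * |(Lc : ℝ) ^ (3 + 2) * respStep (d := 3) 1 (Lc ^ (k + 2)) μ z l x - respStep (d := 3) 1 (Lc ^ (k + 1)) μ z l (quo Lc x)|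
      ≤ ((Lc : ℝ) ^ (k + 1)) ^ 5 * (c₁ * θ₁ ^ k * (((Lc : ℝ) ^ (k + 1)) ^ (3 + 2))⁻¹ * Real.exp (-(κ₀ * supNorm (quo (Lc ^ (k + 2)) x - z)))) :=
        mul_le_mul_of_nonneg_left h (by positivity)
    _ = c₁ * θ₁ ^ k * Real.exp (-(κ₀ * supNorm (quo (Lc ^ (k + 2)) x - z))) := by
        field_simp
        ring

/-- NOT IN PRINT; OUR BOOKKEEPING.  **THE UNIT TENT FORCE, DIFFERENCED ACROSS THE TWO TOWERS** (gan24-p2 g34's `ContactTentRefine.exists_tent_refine_three` shape,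
its unit tent `N⁻¹·𝒬ᵀ_N(N^8·φ) = N^7·𝒬ᵀ_Nφ`, `𝒬ᵀ` being linear): `|N′^7·t_{k+1} κ x − N^7·t_k κ (quo Lc x)| ≤ (Aθt^k + B·N⁻¹)·E′(x)`. -/
theorem abs_unitTent_refine_le
    (hdt : ∀ (k : ℕ) (μ : Fin (3 + 1)) (z : Site (3 + 1)) (κ : Fin (3 + 1)) (x : Site (3 + 1)),
      |(((Lc ^ (k + 1 + 1) : ℕ) : ℝ))⁻¹ *
            contourSumAdj (Lc ^ (k + 1 + 1))
              (fun κ' y => (((Lc : ℝ) ^ (k + 1 + 1)) ^ (2 * (3 + 1))) * wΦ (N := Lc ^ (k + 1 + 1)) (d := 3) κ' μ (y - z)) κ x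
          - (((Lc ^ (k + 1) : ℕ) : ℝ))⁻¹ *
            contourSumAdj (Lc ^ (k + 1))
              (fun κ' y => (((Lc : ℝ) ^ (k + 1)) ^ (2 * (3 + 1))) * wΦ (N := Lc ^ (k + 1)) (d := 3) κ' μ (y - z)) κ (quo Lc x)|
        ≤ (A * θt ^ k + B * (((Lc ^ (k + 1) : ℕ) : ℝ))⁻¹) * Real.exp (-(κ₀ * supNorm (quo (Lc ^ (k + 1)) (quo Lc x) - z))))
    (k : ℕ) (μ : Fin (3 + 1)) (z : Site (3 + 1)) (κ : Fin (3 + 1)) (x : Site (3 + 1)) :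
    |((Lc : ℝ) ^ (k + 2)) ^ 7 * contourSumAdj (Lc ^ (k + 2)) (fun κ' y => wΦ (N := Lc ^ (k + 2)) (d := 3) κ' μ (y - z)) κ x
        - ((Lc : ℝ) ^ (k + 1)) ^ 7 * contourSumAdj (Lc ^ (k + 1)) (fun κ' y => wΦ (N := Lc ^ (k + 1)) (d := 3) κ' μ (y - z)) κ (quo Lc x)|
      ≤ (A * θt ^ k + B * ((Lc : ℝ) ^ (k + 1))⁻¹) * Real.exp (-(κ₀ * supNorm (quo (Lc ^ (k + 2)) x - z))) := by
  have hL0 : (Lc : ℝ) ≠ 0 := by exact_mod_cast NeZero.ne Lc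
  -- the unit tent `N⁻¹·𝒬ᵀ_N(N^8 φ) = N^7·𝒬ᵀ_N φ`
  have e7 : ∀ (n : ℕ) (w : Site (3 + 1)),
      ((Lc : ℝ) ^ n)⁻¹ * contourSumAdj (Lc ^ n) (fun κ' y => (((Lc : ℝ) ^ n) ^ (2 * (3 + 1))) * wΦ (N := Lc ^ n) (d := 3) κ' μ (y - z)) κ w
        = ((Lc : ℝ) ^ n) ^ 7 * contourSumAdj (Lc ^ n) (fun κ' y => wΦ (N := Lc ^ n) (d := 3) κ' μ (y - z)) κ w := by
    intro n w
    have hn : ((Lc : ℝ) ^ n) ≠ 0 := pow_ne_zero _ hL0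
    have cmul : contourSumAdj (Lc ^ n) (fun κ' y => (((Lc : ℝ) ^ n) ^ (2 * (3 + 1))) * wΦ (N := Lc ^ n) (d := 3) κ' μ (y - z)) κ w
        = (((Lc : ℝ) ^ n) ^ (2 * (3 + 1))) * contourSumAdj (Lc ^ n) (fun κ' y => wΦ (N := Lc ^ n) (d := 3) κ' μ (y - z)) κ w := by
      simp only [contourSumAdj, Finset.mul_sum]
    rw [cmul, show ((Lc : ℝ) ^ n) ^ (2 * (3 + 1)) = (Lc : ℝ) ^ n * ((Lc : ℝ) ^ n) ^ 7 by ring, ← mul_assoc, ← mul_assoc,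
      inv_mul_cancel₀ hn, one_mul]
  have h := hdt k μ z κ x
  rw [show k + 1 + 1 = k + 2 from rfl, Nat.cast_pow, Nat.cast_pow, e7 (k + 2) x, e7 (k + 1) (quo Lc x),
    quo_quo' (N' := Lc ^ (k + 2)) (pow_succ' Lc (k + 1))] at h
  exact h

/-- NOT IN PRINT; OUR BOOKKEEPING.  **THE UNIT GAUGE FUNCTION, DIFFERENCED ACROSS THE TWO TOWERS (SITE LETTER)** (leaf-01 g61's `ContactGaugeRefine` shape =
CT-4b's (α) pieces summed + the (δ) piece): `|N′^4·λ_{k+1} x − N^4·λ_k (quo Lc x)| ≤ (16cθ^k + 8C·N⁻¹)·E′(x)` — `N′^4·16Lc·c·θ^k·Lc^{k+1}·Lc^{−5(k+2)} = 16cθ^k`,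
`N′^4·8LcC·Lc^{−5(k+2)} = 8C·Lc^{−(k+1)}`: geometric at `max(θ, Lc⁻¹)` (CT4-DESIGN §2 (δ)). -/
theorem abs_unitGauge_refine_le {rr : Fin (3 + 1) → ℕ}
    (hdl : ∀ (k : ℕ) (μ : Fin (3 + 1)) (z : Site (3 + 1)) (u' : Site (3 + 1)),
      |(Psi (toSite rr) Lc 0 (k + 1) (delta1 μ z) u' - bmGaugeAt (toSite rr) (respStep (d := 3) 1 (Lc ^ (k + 2)) μ z) Lc u')
          - ((Lc : ℝ) ^ (3 + 1))⁻¹ *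
            (Psi (toSite rr) Lc 0 k (delta1 μ z) (blk Lc u') - bmGaugeAt (toSite rr) (respStep (d := 3) 1 (Lc ^ (k + 1)) μ z) Lc (blk Lc u'))|
        ≤ (16 * (Lc : ℝ) * c * θ ^ k * ((Lc : ℝ) ^ (5 * (k + 2)))⁻¹ * (Lc : ℝ) ^ (k + 1) + 8 * (Lc : ℝ) * C * ((Lc : ℝ) ^ (5 * (k + 2)))⁻¹) *
          Real.exp (-(κ₀ * supNorm (quo (Lc ^ (k + 2)) u' - z))))
    (k : ℕ) (μ : Fin (3 + 1)) (z : Site (3 + 1)) (x : Site (3 + 1)) :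
    |((Lc : ℝ) ^ (k + 2)) ^ 4 * (Psi (toSite rr) Lc 0 (k + 1) (delta1 μ z) x - bmGaugeAt (toSite rr) (respStep (d := 3) 1 (Lc ^ (k + 2)) μ z) Lc x)
        - ((Lc : ℝ) ^ (k + 1)) ^ 4 *
          (Psi (toSite rr) Lc 0 k (delta1 μ z) (quo Lc x) - bmGaugeAt (toSite rr) (respStep (d := 3) 1 (Lc ^ (k + 1)) μ z) Lc (quo Lc x))|
      ≤ (16 * c * θ ^ k + 8 * C * ((Lc : ℝ) ^ (k + 1))⁻¹) * Real.exp (-(κ₀ * supNorm (quo (Lc ^ (k + 2)) x - z))) := by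
  have hL0 : (Lc : ℝ) ≠ 0 := by exact_mod_cast NeZero.ne Lc
  have h := hdl k μ z x
  have hbq : blk Lc x = quo Lc x := rfl
  rw [hbq] at h
  have h0 := (abs_nonneg _).trans h
  have e4 : ((Lc : ℝ) ^ (k + 1)) ^ 4 = ((Lc : ℝ) ^ (k + 2)) ^ 4 * ((Lc : ℝ) ^ (3 + 1))⁻¹ := by
    rw [pow_succ (Lc : ℝ) (k + 1), mul_pow]; field_simp
  have e : ((Lc : ℝ) ^ (k + 2)) ^ 4 * (Psi (toSite rr) Lc 0 (k + 1) (delta1 μ z) x - bmGaugeAt (toSite rr) (respStep (d := 3) 1 (Lc ^ (k + 2)) μ z) Lc x)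
        - ((Lc : ℝ) ^ (k + 1)) ^ 4 *
          (Psi (toSite rr) Lc 0 k (delta1 μ z) (quo Lc x) - bmGaugeAt (toSite rr) (respStep (d := 3) 1 (Lc ^ (k + 1)) μ z) Lc (quo Lc x))
      = ((Lc : ℝ) ^ (k + 2)) ^ 4 *
        ((Psi (toSite rr) Lc 0 (k + 1) (delta1 μ z) x - bmGaugeAt (toSite rr) (respStep (d := 3) 1 (Lc ^ (k + 2)) μ z) Lc x)
          - ((Lc : ℝ) ^ (3 + 1))⁻¹ *
            (Psi (toSite rr) Lc 0 k (delta1 μ z) (quo Lc x) - bmGaugeAt (toSite rr) (respStep (d := 3) 1 (Lc ^ (k + 1)) μ z) Lc (quo Lc x))) := by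
    rw [e4]; ring
  rw [e, abs_mul, abs_of_nonneg (by positivity)]
  refine (mul_le_mul_of_nonneg_left h (by positivity)).trans (le_of_eq ?_)
  field_simp
  ring

/-- NOT IN PRINT; OUR BOOKKEEPING.  **THE UNIT GAUGE FUNCTION OF TOWER `k` IS A STAIRCASE** (p2 g34's `gauge_eq_staircase_zero`, scaled by `N^4`). -/
theorem unitGauge_eq_staircase (ρ : Fin (3 + 1) → ℤ) (k : ℕ) (μ : Fin (3 + 1)) (z c : Site (3 + 1)) :
    ((Lc : ℝ) ^ (k + 1)) ^ 4 * (Psi ρ Lc 0 k (delta1 μ z) c - bmGaugeAt ρ (respStep (d := 3) 1 (Lc ^ (k + 1)) μ z) Lc c)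
      = ∑ s ∈ Finset.range (k + 1),
          (fun (s : ℕ) (y : Site (3 + 1)) => ((Lc : ℝ) ^ (k + 1)) ^ 4 *
            -(((Lc : ℝ) ^ ((3 + 1) * s))⁻¹ *
              bmGaugeAt ρ (legAct (respStep (d := 3) (Lc ^ s) (Lc ^ (k + 1))) (delta1 μ z)) Lc y)) s (blk (Lc ^ s) c) := by
  rw [gauge_eq_staircase_zero ρ k μ z c, Finset.mul_sum]

/-- NOT IN PRINT; OUR BOOKKEEPING.  **THE UNIT PIECES CARRY THE AMPLITUDES `8LcC·N⁻¹·Lc^s`** (p2's `abs_gaugePieceZero_le` × `N^4`: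
`N^4·8LcC·Lc^{−5(k+1)}·Lc^s = 8LcC·Lc^s·N⁻¹`). -/
theorem abs_unitGaugePiece_le {rr : Fin (3 + 1) → ℕ}
    (hN1 : ∀ (m k : ℕ) (μ : Fin (3 + 1)) (z : Site (3 + 1)) (l'' : Fin (3 + 1)) (w' : Site (3 + 1)),
      |respStep (d := 3) (Lc ^ m) (Lc ^ (m + k + 1)) μ z l'' w'| ≤
        C * ((Lc : ℝ) ^ (5 * (k + 1)))⁻¹ * Real.exp (-(κ₀ * supNorm (quo (Lc ^ (k + 1)) w' - z))))
    (hrr : rr ∈ box (3 + 1) Lc) (k : ℕ) (μ : Fin (3 + 1)) (z : Site (3 + 1)) {s : ℕ} (hs : s ≤ k) (c' : Site (3 + 1)) :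
    |(fun (s : ℕ) (y : Site (3 + 1)) => ((Lc : ℝ) ^ (k + 1)) ^ 4 *
        -(((Lc : ℝ) ^ ((3 + 1) * s))⁻¹ *
          bmGaugeAt (toSite rr) (legAct (respStep (d := 3) (Lc ^ s) (Lc ^ (k + 1))) (delta1 μ z)) Lc y)) s (blk (Lc ^ s) c')|
      ≤ (8 * (Lc : ℝ) * C * ((Lc : ℝ) ^ (k + 1))⁻¹ * (Lc : ℝ) ^ s) * Real.exp (-(κ₀ * supNorm (quo (Lc ^ (k + 1)) c' - z))) := by
  have hL0 : (Lc : ℝ) ≠ 0 := by exact_mod_cast NeZero.ne Lc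
  have h := abs_gaugePieceZero_le (Lc := Lc) hN1 hrr k μ z hs c'
  have h0 := (abs_nonneg _).trans h
  show |((Lc : ℝ) ^ (k + 1)) ^ 4 * -(((Lc : ℝ) ^ ((3 + 1) * s))⁻¹ *
      bmGaugeAt (toSite rr) (legAct (respStep (d := 3) (Lc ^ s) (Lc ^ (k + 1))) (delta1 μ z)) Lc (blk (Lc ^ s) c'))| ≤ _
  rw [abs_mul, abs_of_nonneg (by positivity : (0 : ℝ) ≤ ((Lc : ℝ) ^ (k + 1)) ^ 4)]
  refine (mul_le_mul_of_nonneg_left h (by positivity)).trans (le_of_eq ?_)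
  field_simp
  ring

/-- [folklore] The realignment weight: `Σ_{s<k+1} (8LcC·N⁻¹·Lc^s)·(Lc^s)⁻¹ = (k+1)·8LcC·N⁻¹`. -/
theorem sum_unitAmp_eq (k : ℕ) (C : ℝ) :
    ∑ s ∈ Finset.range (k + 1), (8 * (Lc : ℝ) * C * ((Lc : ℝ) ^ (k + 1))⁻¹ * (Lc : ℝ) ^ s) * (((Lc ^ s : ℕ) : ℝ))⁻¹
      = ((k : ℝ) + 1) * (8 * (Lc : ℝ) * C * ((Lc : ℝ) ^ (k + 1))⁻¹) := by
  have hL0 : (Lc : ℝ) ≠ 0 := by exact_mod_cast NeZero.ne Lc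
  rw [Finset.sum_congr rfl fun s _ => by
    rw [Nat.cast_pow, mul_assoc, mul_inv_cancel₀ (pow_ne_zero s hL0), mul_one], Finset.sum_const, Finset.card_range, nsmul_eq_mul]
  push_cast
  ring

end Units

end Summit.QuantumFields.BalabanUV.Beta.GAN24.ContactRefineBUnits

end
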